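import Mathlib
import Summits.AtomisticToContinuum.FouriersLaw.Theses.EmbeddedDrudeMourre
import Summits.AtomisticToContinuum.FouriersLaw.Theorems.EmbeddedDrudeMourreMourreDissolutionLevelShiftPushforward
import HarnessLib

/-!
# Stub B1b″ reduces to a second-difference estimate on the period cell
(crux `EmbeddedDrudeMourre.DrudeDissolution`, item stmt-AtomisticToContinuum-12593; `--supports` file for the
registered sub-goal `stub_excursionSecondDifference_of_cube` of stub B1b″ `stub_excursionSecondDifference` of line
`kinetic-polymer-gas-on-the-time-axis`; closes nothing; lead c13 (process B), 2026-08-17)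

WHAT. Stub B1b″ asks for `C, α > 0` with `|∫ (2φ(x) − φ(x+δ) − φ(x−δ)) dm_f(x)| ≤ C δ^{1+α}` for all `δ > 0` and all `C²`
test functions `|φ| ≤ 1`, where `m_f = Ω_*(W dk)` is the bracket-weighted two-phonon density of states (pushforward of
the cell `(−π,π]³`, `W = Φ²/(∏ω)²·[f]²`, `Ω = resonanceFn`). Since `∫ ψ dm_f = ∫_cell W·(ψ ∘ Ω)` for continuous `ψ`
(sibling's LANDED `levelShift_integral_map_withDensity`), B1b″ follows from the same estimate written directly on the
cell — the CUBE form
`|∫_cell W(p)·(2φ(Ω p) − φ(Ω p + δ) − φ(Ω p − δ)) dμc| ≤ C δ^{1+α}` (all continuous `|φ| ≤ 1`),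
which is what the torus toolkit (`EmbeddedDrudeMourreDrudeDissolutionCellSecondDifference`: the `O(δ²)` engine
`cell_abs_integral_secondDiff_le`; cutoffs, gradient flux, sup-norm power counting `η⁻²`, discard `η⁴`, `η = δ^{1/3}`)
proves. This file is that reduction: `stub_excursionSecondDifference_of_cube`.
-/

noncomputable section

open MeasureTheory Set Filter Function Topology Real
open scoped ENNReal
open Literature.MathematicalPhysics.KineticTheory
open Literature.MathematicalPhysics.KineticTheory.PhononBoltzmann

namespace Summit.AtomisticToContinuum.FouriersLaw.Theorems.DrudeDissolution.KineticPolymerGasOnTheTimeAxis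

/-- **B1b″ from its cube form (registered sub-goal `stub_excursionSecondDifference_of_cube`).** For `ω₂ > 0`,
couplings `a, b` and a continuous profile `f`: if the second differences of the level function `Ω = resonanceFn`
tested against the weight `W = Φ²/(∏ω)²·[f]²` ON THE CELL are `O(δ^{1+α})` uniformly over continuous test functions
`|φ| ≤ 1`, then the pushforward `m_f = Ω_*(W dk)` has the second-order modulus of stub B1b″ (same constants).
Proof: `∫ ψ dm_f = ∫_cell W·(ψ∘Ω)` (`levelShift_integral_map_withDensity`). [folklore] -/
theorem stub_excursionSecondDifference_of_cube :
    ∀ ω₂ a b : ℝ, 0 < ω₂ → ∀ f : ℝ → ℝ, Continuous f →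
      (∃ C α : ℝ, 0 < α ∧ ∀ δ : ℝ, 0 < δ → ∀ φ : ℝ → ℝ, Continuous φ → (∀ x, |φ x| ≤ 1) →
        |∫ p, (vertex a b p.1 p.2.2 p.2.1 ^ 2 /
              (dispersion ω₂ p.1 * dispersion ω₂ p.2.2 * dispersion ω₂ p.2.1 *
                dispersion ω₂ (p.1 + p.2.2 - p.2.1)) ^ 2 *
            (f p.1 + f p.2.2 - f p.2.1 - f (p.1 + p.2.2 - p.2.1)) ^ 2) *
            (2 * φ (resonanceFn ω₂ p.1 p.2.2 p.2.1) - φ (resonanceFn ω₂ p.1 p.2.2 p.2.1 + δ) -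
              φ (resonanceFn ω₂ p.1 p.2.2 p.2.1 - δ))
          ∂((volume.restrict (Set.Ioc (-Real.pi) Real.pi)).prod
            ((volume.restrict (Set.Ioc (-Real.pi) Real.pi)).prod
              (volume.restrict (Set.Ioc (-Real.pi) Real.pi))))| ≤ C * δ ^ (1 + α)) →
      ∃ C α : ℝ, 0 < α ∧ ∀ δ : ℝ, 0 < δ → ∀ φ : ℝ → ℝ, ContDiff ℝ 2 φ → (∀ x, |φ x| ≤ 1) →
        |∫ x, (2 * φ x - φ (x + δ) - φ (x - δ))
            ∂(MeasureTheory.Measure.map (fun p : ℝ × ℝ × ℝ => resonanceFn ω₂ p.1 p.2.2 p.2.1)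
              (((volume.restrict (Set.Ioc (-Real.pi) Real.pi)).prod
                  ((volume.restrict (Set.Ioc (-Real.pi) Real.pi)).prod
                    (volume.restrict (Set.Ioc (-Real.pi) Real.pi)))).withDensity
                (fun p : ℝ × ℝ × ℝ => ENNReal.ofReal
                  (vertex a b p.1 p.2.2 p.2.1 ^ 2 /
                      (dispersion ω₂ p.1 * dispersion ω₂ p.2.2 * dispersion ω₂ p.2.1 *
                        dispersion ω₂ (p.1 + p.2.2 - p.2.1)) ^ 2 *
                    (f p.1 + f p.2.2 - f p.2.1 - f (p.1 + p.2.2 - p.2.1)) ^ 2))))| ≤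
          C * δ ^ (1 + α) := by
  intro ω₂ a b hω f hf hcube
  obtain ⟨C, α, hα, hC⟩ := hcube
  refine ⟨C, α, hα, fun δ hδ φ hφ hφ1 => ?_⟩
  -- the weight: continuity and sign; the level function: continuity
  have hden : ∀ p : ℝ × ℝ × ℝ, (dispersion ω₂ p.1 * dispersion ω₂ p.2.2 * dispersion ω₂ p.2.1 *
      dispersion ω₂ (p.1 + p.2.2 - p.2.1)) ^ 2 ≠ 0 := fun p =>
    pow_ne_zero _ (mul_pos (mul_pos (mul_pos (dispersion_pos hω _) (dispersion_pos hω _))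
      (dispersion_pos hω _)) (dispersion_pos hω _)).ne'
  have hV : Continuous fun p : ℝ × ℝ × ℝ => vertex a b p.1 p.2.2 p.2.1 ^ 2 := by fun_prop
  have hD : Continuous fun p : ℝ × ℝ × ℝ => (dispersion ω₂ p.1 * dispersion ω₂ p.2.2 *
      dispersion ω₂ p.2.1 * dispersion ω₂ (p.1 + p.2.2 - p.2.1)) ^ 2 := by fun_prop
  have hB : Continuous fun p : ℝ × ℝ × ℝ =>
      (f p.1 + f p.2.2 - f p.2.1 - f (p.1 + p.2.2 - p.2.1)) ^ 2 := by fun_prop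
  have hW : Continuous fun p : ℝ × ℝ × ℝ => vertex a b p.1 p.2.2 p.2.1 ^ 2 /
      (dispersion ω₂ p.1 * dispersion ω₂ p.2.2 * dispersion ω₂ p.2.1 *
        dispersion ω₂ (p.1 + p.2.2 - p.2.1)) ^ 2 *
      (f p.1 + f p.2.2 - f p.2.1 - f (p.1 + p.2.2 - p.2.1)) ^ 2 := (hV.div hD hden).mul hB
  have hW0 : ∀ p : ℝ × ℝ × ℝ, 0 ≤ vertex a b p.1 p.2.2 p.2.1 ^ 2 /
      (dispersion ω₂ p.1 * dispersion ω₂ p.2.2 * dispersion ω₂ p.2.1 *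
        dispersion ω₂ (p.1 + p.2.2 - p.2.1)) ^ 2 *
      (f p.1 + f p.2.2 - f p.2.1 - f (p.1 + p.2.2 - p.2.1)) ^ 2 := fun p => by positivity
  have hΩ : Continuous fun p : ℝ × ℝ × ℝ => resonanceFn ω₂ p.1 p.2.2 p.2.1 := by fun_prop
  have hψ : Continuous fun x : ℝ => 2 * φ x - φ (x + δ) - φ (x - δ) := by
    have := hφ.continuous; fun_prop
  rw [MourreDissolution.levelShift_integral_map_withDensity hW hW0 hΩ hψ]
  exact hC δ hδ φ hφ.continuous hφ1

end Summit.AtomisticToContinuum.FouriersLaw.Theorems.DrudeDissolution.KineticPolymerGasOnTheTimeAxis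

end
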